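import Summits.Ventures.PercRepro.PuncturedLYMTwoCoHypGenPos

/-!
# PercRepro — TWO CO-HYPERPLANES OF ANY INTERSECTION, PART 6b: THE `+R` WEIGHTS OF THE CORRECTED ROWS AND THE
ASSEMBLY OF POSITIVITY (p10, gen 35)

Arithmetic only, continuing part 6.
* `gGamma_loss_le` — the loss on the `+R` edges of a corrected row is at most `1/C(m₂, b + s)` (the key estimate of
  part 7 at the level `b + s`);  `margin_nonneg` — the margin `1 − f¹_{m₁−1} − f²_c − (1/m₁)/C(m₂, c) ≥ 0`
  (`m₁ = 2` forces `s = 0`, `m₂ = j`);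
* `typeI_R_nonneg`, `typeII_R_nonneg` — the `+R` weights of the type-I and type-II rows;
* **`w3_nonneg`** — every weight is nonnegative on the profiles of `P` (the positivity hypothesis of
  `puncturedNMP_gen_of_seq`).
Nothing here asserts (SP).
-/

namespace PercRepro.PuncturedLYM

open Finset

/-- The loss on the `+R` edges of a corrected row: `b·f²_{b+s−1}/(#B + 1 − b) ≤ 1/C(m₂, b + s)` (`1 ≤ b + s < m₂`). -/
theorem gGamma_loss_le {n j m₂ s b : ℕ} (hm₂ : 1 ≤ m₂) (hm₂j : m₂ ≤ j) (hn : 2 * j + 1 ≤ n) (hbs1 : 1 ≤ b + s)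
    (hbs : b + s < m₂) :
    (b : ℚ) * coF n j m₂ (b + s - 1) / ((m₂ - s + 1 - b : ℕ) : ℚ) ≤ 1 / ((m₂.choose (b + s) : ℕ) : ℚ) := by
  have hkey := coF_pred_bound (n := n) (j := j) (m := m₂) (b := b + s) hm₂ hm₂j hn hbs1 hbs
  have e : m₂ - s + 1 - b = m₂ + 1 - (b + s) := by omega
  rw [e]
  refine le_trans ?_ hkey
  apply div_le_div_of_nonneg_right _ (by positivity)
  have hf := coF_nonneg (m := m₂) (c := b + s - 1) hm₂ hm₂j hn (by omega)
  have : (b : ℚ) ≤ ((b + s : ℕ) : ℚ) := by exact_mod_cast (show b ≤ b + s by omega)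
  exact mul_le_mul_of_nonneg_right this hf

/-- The margin of a corrected row: `1 − f¹_{m₁−1} − f²_c − (1/m₁)/C(m₂, c) ≥ 0` for `1 ≤ c ≤ m₂ − 1`, `2 ≤ m₁, m₂`,
`j + 2 ≤ m₁ + m₂ − s`, `s + 2 ≤ m₁` (`f²_c ≤ δ₂ + 1/C(m₂, c)`, `C(m₂, c) ≥ m₂`; `m₁ = 2` forces `s = 0`, `m₂ = j`). -/
theorem margin_nonneg {n j m₁ m₂ s c : ℕ} (hm₁ : 2 ≤ m₁) (hm₁j : m₁ ≤ j) (hm₂ : 3 ≤ m₂) (hm₂j : m₂ ≤ j)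
    (hn : 2 * j + 1 ≤ n) (hs₁ : s + 2 ≤ m₁) (hbig : j + 2 ≤ m₁ + m₂ - s) (hc1 : 1 ≤ c) (hc : c < m₂) :
    0 ≤ 1 - coF n j m₁ (m₁ - 1) - coF n j m₂ c - 1 / (m₁ : ℚ) * (1 / ((m₂.choose c : ℕ) : ℚ)) := by
  have hm₁q : (2 : ℚ) ≤ m₁ := by exact_mod_cast hm₁
  have hm₁0 : (0 : ℚ) < m₁ := by linarith
  have hC : (m₂ : ℚ) ≤ ((m₂.choose c : ℕ) : ℚ) := by exact_mod_cast le_choose_of_one_le_of_lt hc1 hc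
  have hCpos : (0 : ℚ) < ((m₂.choose c : ℕ) : ℚ) := by
    have : (3 : ℚ) ≤ m₂ := by exact_mod_cast hm₂
    linarith
  set cc := 1 / ((m₂.choose c : ℕ) : ℚ) with hcc
  have hc0 : 0 ≤ cc := by positivity
  have hcm : cc * (m₂ : ℚ) ≤ 1 := by
    rw [hcc, div_mul_eq_mul_div, one_mul, div_le_one hCpos]
    exact hC
  have hm₂3 : (3 : ℚ) ≤ m₂ := by exact_mod_cast hm₂
  have hδ := coDel_le_eighth hm₂ hm₂j hn
  have hFb := coF_le_coDel_add (m := m₂) (c := c) (by omega) hm₂j hn hc.le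
  have hF1 := coF_top_le (m := m₁) (by omega) hm₁j hn
  have hF10 := coF_nonneg (m := m₁) (c := m₁ - 1) (by omega) hm₁j hn (by omega)
  have hL : ((j + 1 - m₁ : ℕ) : ℚ) = (j : ℚ) + 1 - m₁ := by
    rw [Nat.cast_sub (by omega)]
    push_cast
    ring
  have hr1 : (j : ℚ) ≤ ((n - j - 1 : ℕ) : ℚ) := by exact_mod_cast (show j ≤ n - j - 1 by omega)
  have hj0 : (0 : ℚ) < j := by exact_mod_cast (show 0 < j by omega)
  have hF1' : coF n j m₁ (m₁ - 1) * ((m₁ : ℚ) * j) ≤ (j : ℚ) + 1 - m₁ := by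
    rw [hL] at hF1
    have hpos : (0 : ℚ) < (m₁ : ℚ) * ((n - j - 1 : ℕ) : ℚ) := by
      apply mul_pos hm₁0
      linarith
    rw [le_div_iff₀ hpos] at hF1
    calc coF n j m₁ (m₁ - 1) * ((m₁ : ℚ) * j)
        ≤ coF n j m₁ (m₁ - 1) * ((m₁ : ℚ) * ((n - j - 1 : ℕ) : ℚ)) := by
          apply mul_le_mul_of_nonneg_left _ hF10
          apply mul_le_mul_of_nonneg_left hr1 hm₁0.le
      _ ≤ (j : ℚ) + 1 - m₁ := hF1
  have hcc' : 1 / (m₁ : ℚ) * cc ≤ cc / (m₁ : ℚ) := by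
    rw [div_mul_eq_mul_div, one_mul]
  rcases Nat.eq_or_lt_of_le hm₁ with h2 | h3
  · -- `m₁ = 2`: `s = 0` and `m₂ = j`
    have hs0 : s = 0 := by omega
    have hm₂j' : m₂ = j := by omega
    have hm₂jq : (m₂ : ℚ) = j := by exact_mod_cast hm₂j'
    have hm1 : (m₁ : ℚ) = 2 := by exact_mod_cast h2.symm
    rw [hm1] at hF1' ⊢
    have hcj : cc * (j : ℚ) ≤ 1 := by rw [← hm₂jq]; exact hcm
    have hj3 : (3 : ℚ) ≤ j := by rw [← hm₂jq]; exact hm₂3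
    have hF1'' : coF n j m₁ (m₁ - 1) * (2 * (j : ℚ)) ≤ (j : ℚ) - 1 := by linarith
    have key : 0 ≤ (2 * (j : ℚ)) * (1 - coF n j m₁ (m₁ - 1) - coF n j m₂ c - 1 / 2 * cc) := by
      have e : (2 * (j : ℚ)) * (1 - coF n j m₁ (m₁ - 1) - coF n j m₂ c - 1 / 2 * cc) =
          2 * j - coF n j m₁ (m₁ - 1) * (2 * (j : ℚ)) - 2 * j * coF n j m₂ c - j * cc := by ring
      rw [e]
      have h1 : 2 * (j : ℚ) * coF n j m₂ c ≤ 2 * j * (1 / 8 + cc) :=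
        mul_le_mul_of_nonneg_left (by linarith) (by positivity)
      linarith
    have key' : (2 * (j : ℚ)) * 0 ≤ (2 * (j : ℚ)) * (1 - coF n j m₁ (m₁ - 1) - coF n j m₂ c - 1 / 2 * cc) := by
      rw [mul_zero]
      exact key
    exact le_of_mul_le_mul_left key' (by positivity)
  · -- `m₁ ≥ 3`: `f¹ ≤ 1/3`, `cc ≤ 1/3`
    have hm₁3 : (3 : ℚ) ≤ m₁ := by exact_mod_cast h3
    have hF13 : coF n j m₁ (m₁ - 1) ≤ 1 / 3 := by
      have : coF n j m₁ (m₁ - 1) * (3 * (j : ℚ)) ≤ coF n j m₁ (m₁ - 1) * ((m₁ : ℚ) * j) := by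
        apply mul_le_mul_of_nonneg_left _ hF10
        nlinarith
      have : coF n j m₁ (m₁ - 1) * (3 * (j : ℚ)) ≤ j := by linarith
      rw [le_div_iff₀ (by norm_num)]
      nlinarith
    have hc3 : cc ≤ 1 / 3 := by
      rw [le_div_iff₀ (by norm_num)]
      nlinarith
    have hcc3 : 1 / (m₁ : ℚ) * cc ≤ cc / 3 := by
      calc 1 / (m₁ : ℚ) * cc ≤ cc / (m₁ : ℚ) := hcc'
        _ ≤ cc / 3 := div_le_div_of_nonneg_left hc0 (by norm_num) hm₁3
    linarith

/-- **The `+R` weight of a type-I row is nonnegative** (`b + 2 ≤ #B`, `s + 2 ≤ m₁`). -/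
theorem typeI_R_nonneg {n j m₁ m₂ s b : ℕ} (hm₁ : 2 ≤ m₁) (hm₁j : m₁ ≤ j) (hm₂ : 2 ≤ m₂) (hm₂j : m₂ ≤ j)
    (hn : 2 * j + 1 ≤ n) (hs₁ : s + 2 ≤ m₁) (hbig : j + 2 ≤ m₁ + m₂ - s) (hb : b + 2 ≤ m₂ - s) :
    0 ≤ supR n j m₁ m₂ (m₁ - 1) (b + s) + gGamma n j m₁ m₂ s b := by
  have hr : (0 : ℚ) < ((n - j : ℕ) : ℚ) := by
    have : 1 ≤ n - j := by omega
    exact_mod_cast this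
  have hm₁0 : (0 : ℚ) < m₁ := by exact_mod_cast (show 0 < m₁ by omega)
  have hsup := supR_eq (m₁ := m₁) (m₂ := m₂) (a := m₁ - 1) (b := b + s) hn
  rcases Nat.eq_zero_or_pos (b + s) with h0 | hpos
  · -- `b = s = 0`: no loss
    have hb0 : b = 0 := by omega
    have hs0 : s = 0 := by omega
    subst hb0 hs0
    have : gGamma n j m₁ m₂ 0 0 = 0 := by
      unfold gGamma
      simp
    rw [this, add_zero]
    exact supR_nonneg hm₁ hm₁j hm₂ hm₂j hn (by omega) (by omega)
  · have hloss := gGamma_loss_le (n := n) (j := j) (m₂ := m₂) (s := s) (b := b) (by omega) hm₂j hn hpos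
      (by omega)
    have hmargin := margin_nonneg (n := n) (j := j) (m₁ := m₁) (m₂ := m₂) (s := s) (c := b + s) hm₁ hm₁j (by omega)
      hm₂j hn hs₁ hbig hpos (by omega)
    have hγ : gGamma n j m₁ m₂ s b = -((b : ℚ) * coF n j m₂ (b + s - 1) / ((m₂ - s + 1 - b : ℕ) : ℚ)) / (m₁ : ℚ) /
        ((n - j : ℕ) : ℚ) := by
      unfold gGamma
      have : ((m₂ - s + 1 - b : ℕ) : ℚ) ≠ 0 := by
        exact_mod_cast (show m₂ - s + 1 - b ≠ 0 by omega)
      field_simp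
    rw [hγ]
    have hprod : 0 ≤ ((n - j : ℕ) : ℚ) * (supR n j m₁ m₂ (m₁ - 1) (b + s) +
        -((b : ℚ) * coF n j m₂ (b + s - 1) / ((m₂ - s + 1 - b : ℕ) : ℚ)) / (m₁ : ℚ) / ((n - j : ℕ) : ℚ)) := by
      rw [mul_add, hsup]
      have e : ((n - j : ℕ) : ℚ) * (-((b : ℚ) * coF n j m₂ (b + s - 1) / ((m₂ - s + 1 - b : ℕ) : ℚ)) / (m₁ : ℚ) /
          ((n - j : ℕ) : ℚ)) = -((b : ℚ) * coF n j m₂ (b + s - 1) / ((m₂ - s + 1 - b : ℕ) : ℚ)) / (m₁ : ℚ) := by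
        field_simp
      rw [e]
      have : (b : ℚ) * coF n j m₂ (b + s - 1) / ((m₂ - s + 1 - b : ℕ) : ℚ) / (m₁ : ℚ) ≤
          1 / (m₁ : ℚ) * (1 / ((m₂.choose (b + s) : ℕ) : ℚ)) := by
        rw [div_eq_mul_one_div _ (m₁ : ℚ), mul_comm]
        exact mul_le_mul_of_nonneg_left hloss (by positivity)
      rw [neg_div]
      linarith
    by_contra hneg
    have : ((n - j : ℕ) : ℚ) * (supR n j m₁ m₂ (m₁ - 1) (b + s) +
        -((b : ℚ) * coF n j m₂ (b + s - 1) / ((m₂ - s + 1 - b : ℕ) : ℚ)) / (m₁ : ℚ) / ((n - j : ℕ) : ℚ)) < 0 :=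
      mul_neg_of_pos_of_neg hr (not_le.1 hneg)
    linarith

/-- **The `+R` weight of a type-II row is nonnegative** (`1 ≤ s`, `b + 1 ≤ #B`, `s + 2 ≤ m₁`). -/
theorem typeII_R_nonneg {n j m₁ m₂ s b : ℕ} (hm₁j : m₁ ≤ j) (hm₂j : m₂ ≤ j) (hn : 2 * j + 1 ≤ n) (hs : 1 ≤ s)
    (hs₁ : s + 2 ≤ m₁) (hs₂ : s + 2 ≤ m₂) (hb : b + 1 ≤ m₂ - s) :
    0 ≤ supR n j m₁ m₂ (m₁ - 1) (b + s - 1) + gGamma n j m₁ m₂ s b := by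
  have hr : (0 : ℚ) < ((n - j : ℕ) : ℚ) := by
    have : 1 ≤ n - j := by omega
    exact_mod_cast this
  have hm₁0 : (0 : ℚ) < m₁ := by exact_mod_cast (show 0 < m₁ by omega)
  have hm₁3 : (3 : ℚ) ≤ m₁ := by exact_mod_cast (show 3 ≤ m₁ by omega)
  have hm₂3 : (3 : ℚ) ≤ m₂ := by exact_mod_cast (show 3 ≤ m₂ by omega)
  have hsup := supR_eq (m₁ := m₁) (m₂ := m₂) (a := m₁ - 1) (b := b + s - 1) hn
  have hloss := gGamma_loss_le (n := n) (j := j) (m₂ := m₂) (s := s) (b := b) (by omega) hm₂j hn (by omega) (by omega)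
  -- the margin: `f¹ ≤ 1/3`, `f²_{b+s−1} ≤ δ₂ + 1/m₂` (or `= δ₂`), `δ₂ ≤ 1/8`, loss `≤ 1/(m₁·m₂)`
  have hC : (m₂ : ℚ) ≤ ((m₂.choose (b + s) : ℕ) : ℚ) := by exact_mod_cast le_choose_of_one_le_of_lt (by omega) (by omega)
  have hCpos : (0 : ℚ) < ((m₂.choose (b + s) : ℕ) : ℚ) := by linarith
  have hloss' : (b : ℚ) * coF n j m₂ (b + s - 1) / ((m₂ - s + 1 - b : ℕ) : ℚ) ≤ 1 / (m₂ : ℚ) := by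
    refine hloss.trans ?_
    rw [div_le_div_iff₀ hCpos (by linarith)]
    linarith
  have hδ := coDel_le_eighth (m := m₂) (by omega) hm₂j hn
  have hF2 : coF n j m₂ (b + s - 1) ≤ 1 / 8 + 1 / 3 := by
    rcases Nat.eq_zero_or_pos (b + s - 1) with h0 | hpos
    · rw [h0, coF_zero (m := m₂) hn]
      linarith
    · have hFb := coF_le_coDel_add (m := m₂) (c := b + s - 1) (by omega) hm₂j hn (by omega)
      have hC' : (m₂ : ℚ) ≤ ((m₂.choose (b + s - 1) : ℕ) : ℚ) := by
        exact_mod_cast le_choose_of_one_le_of_lt hpos (by omega)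
      have : 1 / ((m₂.choose (b + s - 1) : ℕ) : ℚ) ≤ 1 / 3 := by
        rw [div_le_div_iff₀ (by linarith) (by norm_num)]
        linarith
      linarith
  have hF1 := coF_top_le (m := m₁) (by omega) hm₁j hn
  have hF10 := coF_nonneg (m := m₁) (c := m₁ - 1) (by omega) hm₁j hn (by omega)
  have hL : ((j + 1 - m₁ : ℕ) : ℚ) = (j : ℚ) + 1 - m₁ := by
    rw [Nat.cast_sub (by omega)]
    push_cast
    ring
  have hr1 : (j : ℚ) ≤ ((n - j - 1 : ℕ) : ℚ) := by exact_mod_cast (show j ≤ n - j - 1 by omega)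
  have hj0 : (0 : ℚ) < j := by exact_mod_cast (show 0 < j by omega)
  have hF13 : coF n j m₁ (m₁ - 1) ≤ 1 / 3 := by
    rw [hL] at hF1
    have hpos : (0 : ℚ) < (m₁ : ℚ) * ((n - j - 1 : ℕ) : ℚ) := by
      apply mul_pos hm₁0
      linarith
    rw [le_div_iff₀ hpos] at hF1
    have h1 : coF n j m₁ (m₁ - 1) * (3 * (j : ℚ)) ≤ coF n j m₁ (m₁ - 1) * ((m₁ : ℚ) * ((n - j - 1 : ℕ) : ℚ)) := by
      apply mul_le_mul_of_nonneg_left _ hF10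
      nlinarith
    have h2 : coF n j m₁ (m₁ - 1) * (3 * (j : ℚ)) ≤ j := by linarith
    rw [le_div_iff₀ (by norm_num)]
    nlinarith
  have hlossm : (b : ℚ) * coF n j m₂ (b + s - 1) / ((m₂ - s + 1 - b : ℕ) : ℚ) / (m₁ : ℚ) ≤ 1 / 9 := by
    calc (b : ℚ) * coF n j m₂ (b + s - 1) / ((m₂ - s + 1 - b : ℕ) : ℚ) / (m₁ : ℚ)
        ≤ (1 / (m₂ : ℚ)) / (m₁ : ℚ) := div_le_div_of_nonneg_right hloss' hm₁0.le
      _ ≤ (1 / 3) / 3 := by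
          apply div_le_div₀ (by norm_num) _ (by norm_num) hm₁3
          rw [div_le_div_iff₀ (by linarith) (by norm_num)]
          linarith
      _ = 1 / 9 := by norm_num
  have hγ : gGamma n j m₁ m₂ s b = -((b : ℚ) * coF n j m₂ (b + s - 1) / ((m₂ - s + 1 - b : ℕ) : ℚ)) / (m₁ : ℚ) /
      ((n - j : ℕ) : ℚ) := by
    unfold gGamma
    have : ((m₂ - s + 1 - b : ℕ) : ℚ) ≠ 0 := by
      exact_mod_cast (show m₂ - s + 1 - b ≠ 0 by omega)
    field_simp
  rw [hγ]
  have hprod : 0 ≤ ((n - j : ℕ) : ℚ) * (supR n j m₁ m₂ (m₁ - 1) (b + s - 1) +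
      -((b : ℚ) * coF n j m₂ (b + s - 1) / ((m₂ - s + 1 - b : ℕ) : ℚ)) / (m₁ : ℚ) / ((n - j : ℕ) : ℚ)) := by
    rw [mul_add, hsup]
    have e : ((n - j : ℕ) : ℚ) * (-((b : ℚ) * coF n j m₂ (b + s - 1) / ((m₂ - s + 1 - b : ℕ) : ℚ)) / (m₁ : ℚ) /
        ((n - j : ℕ) : ℚ)) = -((b : ℚ) * coF n j m₂ (b + s - 1) / ((m₂ - s + 1 - b : ℕ) : ℚ) / (m₁ : ℚ)) := by
      field_simp
    rw [e]
    linarith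
  by_contra hneg
  have : ((n - j : ℕ) : ℚ) * (supR n j m₁ m₂ (m₁ - 1) (b + s - 1) +
      -((b : ℚ) * coF n j m₂ (b + s - 1) / ((m₂ - s + 1 - b : ℕ) : ℚ)) / (m₁ : ℚ) / ((n - j : ℕ) : ℚ)) < 0 :=
    mul_neg_of_pos_of_neg hr (not_le.1 hneg)
  linarith

/-- `gBeta ≥ 0` for `b + s ≤ m₂`. -/
theorem gBeta_nonneg {n j m₁ m₂ s b : ℕ} (hm₂ : 1 ≤ m₂) (hm₂j : m₂ ≤ j) (hn : 2 * j + 1 ≤ n) (hbs : b + s ≤ m₂) :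
    0 ≤ gBeta n j m₁ m₂ s b := by
  unfold gBeta
  apply div_nonneg (mul_nonneg (by positivity) (coF_nonneg hm₂ hm₂j hn hbs)) (by positivity)

/-- `supD ≥ 0` for `c₁ < m₁`, `c₂ < m₂`. -/
theorem supD_nonneg {n j m₁ m₂ c₁ c₂ : ℕ} (hm₁ : 1 ≤ m₁) (hm₁j : m₁ ≤ j) (hm₂ : 1 ≤ m₂) (hm₂j : m₂ ≤ j)
    (hn : 2 * j + 1 ≤ n) (hc₁ : c₁ < m₁) (hc₂ : c₂ < m₂) : 0 ≤ supD n j m₁ m₂ c₁ c₂ := by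
  have hr : (0 : ℚ) < ((n - j : ℕ) : ℚ) := by
    have : 1 ≤ n - j := by omega
    exact_mod_cast this
  have h := supD_eq (m₁ := m₁) (m₂ := m₂) (c₁ := c₁) (c₂ := c₂) hn
  have h1 := coG_nonneg hm₁ hm₁j hn hc₁
  have h2 := coG_nonneg hm₂ hm₂j hn hc₂
  have hprod : 0 ≤ ((n - j : ℕ) : ℚ) * supD n j m₁ m₂ c₁ c₂ := by rw [h]; linarith
  by_contra hneg
  have : ((n - j : ℕ) : ℚ) * supD n j m₁ m₂ c₁ c₂ < 0 := mul_neg_of_pos_of_neg hr (not_le.1 hneg)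
  linarith

/-- The `+A` weight is nonnegative on the profiles of `P`. -/
theorem w3A_nonneg {n j m₁ m₂ s : ℕ} (hm₁j : m₁ ≤ j) (hm₂j : m₂ ≤ j) (hs₁ : s + 2 ≤ m₁) (hs₂ : s + 2 ≤ m₂)
    (hn : 2 * j + 1 ≤ n) (a b d : ℕ) (ha : a ≤ m₁ - s) (hb : b ≤ m₂ - s) (hd : d ≤ s)
    (h1 : ¬ (a = m₁ - s ∧ d = s)) (h2 : ¬ (b = m₂ - s ∧ d = s)) : 0 ≤ w3A n j m₁ m₂ s a b d := by
  unfold w3A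
  split_ifs with hI hI' hII
  · exact typeI_A_nonneg (by omega) hm₁j (by omega) hm₂j hn (by omega) (by omega)
  · exact add_nonneg (supA_nonneg (by omega) hm₁j (by omega) hm₂j hn (by omega) (by omega))
      (gBeta_nonneg (by omega) hm₁j hn (by omega))
  · exact add_nonneg (supA_nonneg (by omega) hm₁j (by omega) hm₂j hn (by omega) (by omega))
      (gBeta_nonneg (by omega) hm₁j hn (by omega))
  · exact supA_nonneg (by omega) hm₁j (by omega) hm₂j hn (by omega) (by omega)

/-- The `+D` weight is nonnegative on the profiles of `P`. -/
theorem w3D_nonneg {n j m₁ m₂ s : ℕ} (hm₁j : m₁ ≤ j) (hm₂j : m₂ ≤ j) (hs₁ : s + 2 ≤ m₁) (hs₂ : s + 2 ≤ m₂)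
    (hn : 2 * j + 1 ≤ n) (a b d : ℕ) (ha : a ≤ m₁ - s) (hb : b ≤ m₂ - s) (hd : d ≤ s)
    (h1 : ¬ (a = m₁ - s ∧ d = s)) (h2 : ¬ (b = m₂ - s ∧ d = s)) : 0 ≤ w3D n j m₁ m₂ s a b d := by
  unfold w3D
  split_ifs with hII hII'
  · exact typeII_D_nonneg (by omega) hm₁j (by omega) hm₂j hn (by omega) (by omega)
  · rw [supD_symm n j m₁ m₂ (a + s - 1) (m₂ - 1)]
    exact typeII_D_nonneg (by omega) hm₂j (by omega) hm₁j hn (by omega) (by omega)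
  · exact supD_nonneg (by omega) hm₁j (by omega) hm₂j hn (by omega) (by omega)

/-- The `+R` weight is nonnegative on the profiles of `P`. -/
theorem w3R_nonneg {n j m₁ m₂ s : ℕ} (hm₁j : m₁ ≤ j) (hm₂j : m₂ ≤ j) (hs₁ : s + 2 ≤ m₁) (hs₂ : s + 2 ≤ m₂)
    (hbig : j + 2 ≤ m₁ + m₂ - s) (hn : 2 * j + 1 ≤ n) (a b d : ℕ) (ha : a ≤ m₁ - s) (hb : b ≤ m₂ - s) (hd : d ≤ s)
    (h1 : ¬ (a = m₁ - s ∧ d = s)) (h2 : ¬ (b = m₂ - s ∧ d = s)) : 0 ≤ w3R n j m₁ m₂ s a b d := by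
  unfold w3R
  split_ifs with hc hI hI' hII hII'
  · exact gCornerR_nonneg (by omega) hm₁j (by omega) hm₂j hn (by omega) (by omega)
  · exact typeI_R_nonneg (by omega) hm₁j (by omega) hm₂j hn hs₁ hbig (by omega)
  · rw [supR_symm n j m₁ m₂ (a + s) (m₂ - 1)]
    exact typeI_R_nonneg (by omega) hm₂j (by omega) hm₁j hn hs₂ (by omega) (by omega)
  · exact typeII_R_nonneg hm₁j hm₂j hn (by omega) hs₁ hs₂ (by omega)
  · rw [supR_symm n j m₁ m₂ (a + s - 1) (m₂ - 1)]
    exact typeII_R_nonneg hm₂j hm₁j hn (by omega) hs₂ hs₁ (by omega)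
  · exact supR_nonneg (by omega) hm₁j (by omega) hm₂j hn (by omega) (by omega)

/-- **POSITIVITY**: every weight is nonnegative on the profiles of `P`. -/
theorem w3_nonneg {n j m₁ m₂ s : ℕ} (hm₁j : m₁ ≤ j) (hm₂j : m₂ ≤ j) (hs₁ : s + 2 ≤ m₁) (hs₂ : s + 2 ≤ m₂)
    (hbig : j + 2 ≤ m₁ + m₂ - s) (hn : 2 * j + 1 ≤ n) (a b d : ℕ) (ha : a ≤ m₁ - s) (hb : b ≤ m₂ - s) (hd : d ≤ s)
    (h1 : ¬ (a = m₁ - s ∧ d = s)) (h2 : ¬ (b = m₂ - s ∧ d = s)) :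
    0 ≤ w3A n j m₁ m₂ s a b d ∧ 0 ≤ w3B n j m₁ m₂ s a b d ∧ 0 ≤ w3D n j m₁ m₂ s a b d ∧ 0 ≤ w3R n j m₁ m₂ s a b d := by
  refine ⟨w3A_nonneg hm₁j hm₂j hs₁ hs₂ hn a b d ha hb hd h1 h2, ?_, w3D_nonneg hm₁j hm₂j hs₁ hs₂ hn a b d ha hb hd h1 h2,
    w3R_nonneg hm₁j hm₂j hs₁ hs₂ hbig hn a b d ha hb hd h1 h2⟩
  rw [w3B_symm]
  exact w3A_nonneg hm₂j hm₁j hs₂ hs₁ hn b a d hb ha hd h2 h1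

end PercRepro.PuncturedLYM
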